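import Literature.NumberTheory.Automorphic.Liu2021.LemD1AsPrintedIndexedNonVacuityInertConverse
import Literature.NumberTheory.Automorphic.Liu2021.LemD1AsPrintedIndexedNonVacuityRamifiedPlace
import HarnessLib

/-!
# [Liu2021, App. D Lemma D.1 (3)] bookkeeping — RAMIFIED non-split places of ANY quadratic `E/F`: the conjugation is TRIVIAL on the
# residue field, `E_v¹` is `N`-DIVISIBLE for every ODD `N` with `v_w(N) = 1`, so NO det-line carrier with trivial central character exists

Reproduction ∕ bookkeeping (Literature, THEOREMS ONLY: no definition, no record, no named fact, no `sorry`; nothing is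
asserted about Liu's oscillator representations or about the tree's constructed local Weil carriers).

Sequel of ✔ `…InertConverse.lean` (inert tame places with `gcd(N, q_v + 1) = 1`: `E_w¹ = (E_w¹)^N`, no det-line carrier) and of
✔ `…RamifiedPlace.lean` (`e · f = 2` at a non-split place; `e(w|v) ≠ 1` ⇒ `e = 2`, `f = 1`).  ✔ `…TorsionCarrier`'s «What this does NOT
give» had «impossible-for-lines at ramified `w`, `N` odd» as an open remark; THIS FILE proves it, for ANY quadratic extension of number
fields `E/F` (`c ≠ 1`), at every place `w ∣ v` with `c • w = w` and `e(w|v) ≠ 1`: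

* §1 **`smul_sub_mem_of_ramified`** — `c` acts TRIVIALLY on `κ(w)`: `c • u − u ∈ 𝔭_w` for every `u ∈ 𝓞_E` (the inertia group has order
  `e(w|v) = 2 = #Aut(E/F)`, Mathlib `Ideal.card_inertia_eq_ramificationIdxIn`, so `c ∈ I_w`); `mul_smul_sub_sq_mem_of_ramified`
  (`u · (c • u) ≡ u² (mod 𝔭_w)`).
* §2 (the completion) **`valued_galAdicCompletionMap_sub_lt_one_of_ramified`** (`v_w(c_w(y) − y) < 1` for `v_w(y) ≤ 1`: density of `𝓞_E`
  in `𝒪_w` + §1) and `galAdicCompletionMap_eq_self_of_pow_eq_one` (`c_w(ζ) = ζ` for every `N`-th root of unity `ζ ∈ E_w`, `v_w(N) = 1`: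
  §2 + «no prime-to-`p` torsion among principal units», ✔ `…InertConverse.eq_one_of_pow_eq_one_of_valued_sub_one_lt`).
* §3 **`exists_pow_eq_of_mul_galAdicCompletionMap_eq_one_of_ramified`** — for `N` ODD with `v_w(N) = 1`, every `z ∈ E_w` with
  `z · c_w(z) = 1` is `y^N` with `y · c_w(y) = 1`.  PROOF: `z² ≡ z · c_w(z) = 1`, so `z ≡ s` with `s = ±1` (`s · c_w(s) = s² = 1`,
  `s^N = s`); `z s` is a norm-one PRINCIPAL unit, hence `r^N` (Hensel, ✔ `exists_pow_eq_of_norm_sub_one_lt`); `t = r · c_w(r)` is an `N`-th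
  root of unity FIXED by `c_w`, and with `a N + 2 b = 1`, `ζ = t^{−b}` has `ζ · c_w(ζ) = ζ² = t^{−1}`; `y = s · r ζ`.
* §4 (place model of [Liu2021, App. D §D.1], any hermitian `J`, `N ≥ 2`) **`exists_pow_eq_of_mem_normOne_of_ramified`** (`S.normOne = E_v¹` is
  `N`-divisible for `N` odd, `v_w(N) = 1`), `forall_apply_eq_one_of_forall_pow_of_ramified`, and **`eq_one_of_factors_through_det_of_ramified`**:
  EVERY character of `U(V)(F_v) = S.U` factoring through `det` and trivial on the centre is TRIVIAL — no det-line carrier.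
* §5 the CM rows (`L` CM, `F = L⁺`, `c` = complex conjugation): the same; for THE END's `N = 3`: every place of `L⁺` RAMIFIED in `L` and not
  above `3` carries NO det-line `μ`-separating carrier.

Picture for an auditor of the END rows `hD1''` ∕ `hD3` (our bookkeeping, not a claim about Liu's objects), `N = 3`, ANY CM field `L`, every
finite place `v` of `L⁺` and `w ∣ v`: the lineage's det-line device separates the `μ`-conjunct of [Lem. D.1 (3)] AS PRINTED at `w` IF AND ONLY
IF `w` is split (✔ DetCarrier), or `w ∣ 3` (✔ WildCarrier), or `w` is inert with `q_v ≡ 2 (mod 3)` (✔ InertCarrier); at inert `w ∤ 3` with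
`q_v ≢ 2 (mod 3)` (✔ InertConverse) and at ramified `w ∤ 3` (this file) there is none.  Whether NON-line carriers separate there is not treated.

What this does NOT give: `N` even at ramified places (there `−1 ∉ (E_w¹)^N` can happen); carriers that do not factor through `det`; anything
about the rows' OWN carriers `𝓢.omegaLoc v`; Lem. D.1 itself.  HC_CM is NOT proved.

Cell pub-hodgecm2 (COR-CM), audit class of the END rows `hD1''` ∕ `hD3`; seat prover-pub-hodgecm2-b10.

References: [Liu2021] Y. Liu, *Fourier–Jacobi cycles and arithmetic relative trace formula*, Camb. J. Math. 9 (2021) =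
arXiv:2102.11518, App. D §D.1 (l. 5213–5221), Lemma D.1 (3) (l. 5233); [Mok2014] C. P. Mok, Mem. AMS 235 (2015), §1 Notation p. 5;
[NeukirchANT1999] J. Neukirch, *Algebraic Number Theory* (1999), Ch. I §9 Def. (9.5) ∕ Prop. (9.6) (inertia group, `#I_𝔓 = e`),
Ch. II §3 Prop. (3.10), §4 Prop. (4.3) and Lemma (4.6) (Hensel), §5 Prop. (5.3); [CasselsFrohlichANT1967] Ch. II §10, Ch. VII §1.1.
-/

noncomputable section

open scoped Matrix MatrixGroups Valued
open NumberField IsDedekindDomain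
open Literature.RepresentationTheory
open Literature.RepresentationTheory.Liu2021 (OscillatorStandingData)
open Literature.NumberTheory.GaloisRepresentations (HeckeCharacter)

namespace Literature.NumberTheory.Automorphic.Liu2021.LemD1IndexedNonVacuityRamifiedConverse

open UnitaryGroup

/-! ## §1 At a RAMIFIED non-split place `c` acts trivially on the residue field -/

section Global

variable {F : Type} (E : Type) [Field F] [NumberField F] [Field E] [NumberField E] [Algebra F E]
  [Algebra.IsQuadraticExtension F E] (c : E ≃ₐ[F] E) (v : HeightOneSpectrum (𝓞 F))

/-- **at a RAMIFIED non-split place `c` lies in the inertia group: `c • u − u ∈ 𝔭_w` for every `u ∈ 𝓞_E`.**  For `w ∣ v` with `c • w = w`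
and `e(w|v) ≠ 1` one has `e(w|v) = 2` (✔ `…RamifiedPlace.ramificationIdx'_eq_two_of_ne_one`), the inertia group `I_w ≤ Aut(E/F)` has order
`e = 2 = #Aut(E/F)` (Mathlib `Ideal.card_inertia_eq_ramificationIdxIn`), so `I_w = Aut(E/F) ∋ c`.
[cite: NeukirchANT1999, Ch. I §9 Def. (9.5) and Prop. (9.6)] -/
theorem smul_sub_mem_of_ramified (hc : c ≠ 1) (w : PlacesOver E v) (hw : c • w.1 = w.1)
    (he : v.asIdeal.ramificationIdx' w.1.asIdeal ≠ 1) (u : 𝓞 E) : c • u - u ∈ w.1.asIdeal := by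
  classical
  haveI := PlacesOver.liesOver (E := E) w
  haveI : v.asIdeal.IsMaximal := v.isMaximal
  haveI : w.1.asIdeal.IsMaximal := w.1.isMaximal
  haveI : IsGaloisGroup (E ≃ₐ[F] E) (𝓞 F) (𝓞 E) := IsGaloisGroup.of_isFractionRing _ _ _ F E
  have he2 : v.asIdeal.ramificationIdxIn (𝓞 E) = 2 := by
    rw [Ideal.ramificationIdxIn_eq_ramificationIdx v.asIdeal w.1.asIdeal (E ≃ₐ[F] E),
      ← Ideal.ramificationIdx'_eq_ramificationIdx v.asIdeal w.1.asIdeal v.ne_bot]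
    exact LemD1IndexedNonVacuityRamifiedPlace.ramificationIdx'_eq_two_of_ne_one E v c hc w hw he
  have hcard : Nat.card (E ≃ₐ[F] E) = 2 := by
    rw [IsGalois.card_aut_eq_finrank, Algebra.IsQuadraticExtension.finrank_eq_two]
  have htop : w.1.asIdeal.inertia (E ≃ₐ[F] E) = ⊤ := by
    apply Subgroup.eq_top_of_card_eq
    rw [Ideal.card_inertia_eq_ramificationIdxIn (G := E ≃ₐ[F] E) v.asIdeal w.1.asIdeal, he2, hcard]
  have hcI : c ∈ w.1.asIdeal.inertia (E ≃ₐ[F] E) := by rw [htop]; exact Subgroup.mem_top c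
  exact hcI u

/-- **modulo a ramified non-split place the norm is the SQUARE**: `u · (c • u) − u² ∈ 𝔭_w`. [cite: NeukirchANT1999, Ch. I §9 Prop. (9.6)] -/
theorem mul_smul_sub_sq_mem_of_ramified (hc : c ≠ 1) (w : PlacesOver E v) (hw : c • w.1 = w.1)
    (he : v.asIdeal.ramificationIdx' w.1.asIdeal ≠ 1) (u : 𝓞 E) : u * (c • u) - u ^ 2 ∈ w.1.asIdeal := by
  have h := Ideal.mul_mem_left w.1.asIdeal u (smul_sub_mem_of_ramified E c v hc w hw he u)
  have hrw : u * (c • u) - u ^ 2 = u * (c • u - u) := by ring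
  rwa [hrw]

end Global

/-! ## §2 The completion: `c_w ≡ id (mod 𝔪_w)` on `𝒪_w`, and `c_w(ζ) = ζ` on the prime-to-`p` roots of unity -/

section Completion

variable {F : Type} (E : Type) [Field F] [NumberField F] [Field E] [NumberField E] [Algebra F E]
  [Algebra.IsQuadraticExtension F E] (c : E ≃ₐ[F] E) (v : HeightOneSpectrum (𝓞 F))

/-- **`c_w ≡ id (mod 𝔪_w)` at a RAMIFIED non-split place**: `v_w(c_w(y) − y) < 1` for every `y ∈ E_w` with `v_w(y) ≤ 1`
(`c_w = galAdicCompletionMap c hw`; density of `𝓞_E` in `𝒪_w`, ✔ `exists_ringOfIntegers_valued_sub_lt_one`, + §1).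
[cite: NeukirchANT1999, Ch. I §9 Prop. (9.6) and Ch. II §4 Prop. (4.3)] -/
theorem valued_galAdicCompletionMap_sub_lt_one_of_ramified (hc : c ≠ 1) (w : PlacesOver E v) (hw : c • w.1 = w.1)
    (he : v.asIdeal.ramificationIdx' w.1.asIdeal ≠ 1) (y : w.1.adicCompletion E) (hy : Valued.v y ≤ 1) :
    Valued.v (galAdicCompletionMap c hw y - y) < 1 := by
  obtain ⟨u, hu⟩ := Literature.NumberTheory.Automorphic.exists_ringOfIntegers_valued_sub_lt_one E w.1 ⟨y, hy⟩
  set a : w.1.adicCompletion E := (((u : 𝓞 E) : E) : w.1.adicCompletion E) with ha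
  have hua : algebraMap E (w.1.adicCompletion E) (algebraMap (𝓞 E) E u) = a := rfl
  rw [hua] at hu
  change Valued.v (a - y) < 1 at hu
  have hca : galAdicCompletionMap c hw a = (((c • u : 𝓞 E) : E) : w.1.adicCompletion E) := by
    rw [ha, galAdicCompletionMap_coe_algEquiv]
    rfl
  have hcong : Valued.v ((((c • u : 𝓞 E) : E) : w.1.adicCompletion E) - a) < 1 := by
    have : (((c • u : 𝓞 E) : E) : w.1.adicCompletion E) - a = (((c • u - u : 𝓞 E) : E) : w.1.adicCompletion E) := by
      have h1 : ((c • u - u : 𝓞 E) : E) = ((c • u : 𝓞 E) : E) - ((u : 𝓞 E) : E) := by push_cast; rfl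
      rw [ha]
      change algebraMap E (w.1.adicCompletion E) ((c • u : 𝓞 E) : E) - algebraMap E (w.1.adicCompletion E) ((u : 𝓞 E) : E) =
        algebraMap E (w.1.adicCompletion E) ((c • u - u : 𝓞 E) : E)
      rw [h1, map_sub]
    rw [this, HeightOneSpectrum.valuedAdicCompletion_eq_valuation', RingOfIntegers.coe_eq_algebraMap,
      HeightOneSpectrum.valuation_lt_one_iff_mem]
    exact smul_sub_mem_of_ramified E c v hc w hw he u
  have hsplit : galAdicCompletionMap c hw y - y =
      galAdicCompletionMap c hw (y - a) + ((((c • u : 𝓞 E) : E) : w.1.adicCompletion E) - a) + (a - y) := by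
    rw [map_sub, hca]; ring
  rw [hsplit]
  refine (Valuation.map_add _ _ _).trans_lt (max_lt ((Valuation.map_add _ _ _).trans_lt (max_lt ?_ hcong)) hu)
  rw [valued_galAdicCompletionMap, Valuation.map_sub_swap]
  exact hu

/-- **`c_w(ζ) = ζ` for every root of unity `ζ ∈ E_w` of order prime to the residue characteristic at a RAMIFIED non-split place**
(`ζ^N = 1`, `v_w(N) = 1`): `c_w(ζ) ∕ ζ` is an `N`-th root of unity and a principal unit (§2), hence `1`
(✔ `…InertConverse.eq_one_of_pow_eq_one_of_valued_sub_one_lt`). [cite: NeukirchANT1999, Ch. I §9 Prop. (9.6) and Ch. II §5 Prop. (5.3)] -/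
theorem galAdicCompletionMap_eq_self_of_pow_eq_one (hc : c ≠ 1) (w : PlacesOver E v) (hw : c • w.1 = w.1)
    (he : v.asIdeal.ramificationIdx' w.1.asIdeal ≠ 1) {N : ℕ} (hN0 : N ≠ 0) (hN : Valued.v ((N : w.1.adicCompletion E)) = 1)
    {ζ : w.1.adicCompletion E} (hζ : ζ ^ N = 1) : galAdicCompletionMap c hw ζ = ζ := by
  have hζv : Valued.v ζ = 1 := (pow_eq_one_iff_left hN0).1 (by rw [← Valuation.map_pow, hζ, Valuation.map_one])
  have hζ0 : ζ ≠ 0 := fun h => by rw [h, Valuation.map_zero] at hζv; exact zero_ne_one hζv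
  have hlt := valued_galAdicCompletionMap_sub_lt_one_of_ramified E c v hc w hw he ζ hζv.le
  set t := galAdicCompletionMap c hw ζ * ζ⁻¹ with ht
  have ht1 : Valued.v (t - 1) < 1 := by
    have hrw : t - 1 = (galAdicCompletionMap c hw ζ - ζ) * ζ⁻¹ := by rw [ht, sub_mul, mul_inv_cancel₀ hζ0]
    rw [hrw, Valuation.map_mul, map_inv₀, hζv, inv_one, mul_one]
    exact hlt
  have htN : t ^ N = 1 := by rw [ht, mul_pow, ← map_pow, hζ, map_one, one_mul, inv_pow, hζ, inv_one]
  have := LemD1IndexedNonVacuityInertConverse.eq_one_of_pow_eq_one_of_valued_sub_one_lt w.1 hN ht1 htN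
  rw [ht] at this
  calc galAdicCompletionMap c hw ζ = galAdicCompletionMap c hw ζ * ζ⁻¹ * ζ := by rw [mul_assoc, inv_mul_cancel₀ hζ0, mul_one]
    _ = ζ := by rw [this, one_mul]

/-! ## §3 `E_w¹` is `N`-DIVISIBLE for `N` odd with `v_w(N) = 1` at a ramified non-split place -/

/-- **`E_w¹ = (E_w¹)^N` at a RAMIFIED non-split place for `N` ODD with `v_w(N) = 1`**: every `z ∈ E_w` with `z · c_w(z) = 1` is `y^N`
with `y · c_w(y) = 1`.  PROOF: `z² ≡ z · c_w(z) = 1 (mod 𝔪_w)` (§2), so `z ≡ s`, `s = ±1`; `z s` is a norm-one principal unit, `= r^N` by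
Hensel (✔ `exists_pow_eq_of_norm_sub_one_lt`); `t = r · c_w(r)` satisfies `t^N = 1` and `c_w(t) = t`; with `a N + b 2 = 1` (`N` odd) and
`ζ = t^{−b}`: `ζ · c_w(ζ) = ζ² = t^{−1}` (§2); `y = s · r ζ` (`s^N = s`, `s² = 1`). [cite: NeukirchANT1999, Ch. II §4 Lemma (4.6) and §5 Prop. (5.3)] -/
theorem exists_pow_eq_of_mul_galAdicCompletionMap_eq_one_of_ramified (hc : c ≠ 1) (w : PlacesOver E v) (hw : c • w.1 = w.1)
    (he : v.asIdeal.ramificationIdx' w.1.asIdeal ≠ 1) {N : ℕ} (hNodd : Odd N) (hNv : Valued.v ((N : w.1.adicCompletion E)) = 1)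
    (z : w.1.adicCompletion E) (hz : z * galAdicCompletionMap c hw z = 1) :
    ∃ y : w.1.adicCompletion E, y * galAdicCompletionMap c hw y = 1 ∧ y ^ N = z := by
  classical
  have hN0 : N ≠ 0 := by rintro rfl; exact (Nat.not_odd_zero hNodd).elim
  have hvcw : ∀ x : w.1.adicCompletion E, Valued.v (galAdicCompletionMap c hw x) = Valued.v x := fun x =>
    valued_galAdicCompletionMap E c hw x
  -- (1) `v(z) = 1`
  have hz1 : Valued.v z = 1 := by
    have h := congrArg Valued.v hz
    rw [Valuation.map_mul, hvcw, Valuation.map_one, ← sq] at h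
    exact (pow_eq_one_iff_left two_ne_zero).1 h
  have hz0 : z ≠ 0 := fun h => by rw [h, Valuation.map_zero] at hz1; exact zero_ne_one hz1
  -- (2) `z ≡ ±1`: `(z - 1)(z + 1) = z² - 1 ≡ z c_w z - 1 = 0`
  have hprod : Valued.v ((z - 1) * (z + 1)) < 1 := by
    have hrw : (z - 1) * (z + 1) = z * (z - galAdicCompletionMap c hw z) := by
      have : z * galAdicCompletionMap c hw z = 1 := hz
      linear_combination this
    rw [hrw, Valuation.map_mul, hz1, one_mul, Valuation.map_sub_swap]
    exact valued_galAdicCompletionMap_sub_lt_one_of_ramified E c v hc w hw he z hz1.le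
  obtain ⟨s, hs2, hsN, hzs⟩ : ∃ s : w.1.adicCompletion E, s * s = 1 ∧ s ^ N = s ∧ Valued.v (z * s - 1) < 1 := by
    by_cases h1 : Valued.v (z - 1) < 1
    · exact ⟨1, one_mul 1, one_pow N, by rwa [mul_one]⟩
    · have hle : Valued.v (z - 1) ≤ 1 :=
        (Valuation.map_sub _ _ _).trans (max_le hz1.le (le_of_eq Valued.v.map_one))
      have heq : Valued.v (z - 1) = 1 := le_antisymm hle (not_lt.1 h1)
      have h2 : Valued.v (z + 1) < 1 := by
        rw [Valuation.map_mul, heq, one_mul] at hprod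
        exact hprod
      refine ⟨-1, by ring, by rw [hNodd.neg_one_pow], ?_⟩
      have : z * -1 - 1 = -(z + 1) := by ring
      rw [this, Valuation.map_neg]
      exact h2
  have hs0 : s ≠ 0 := fun h => by rw [h, mul_zero] at hs2; exact zero_ne_one hs2
  have hsv : Valued.v s = 1 := by
    have h := congrArg Valued.v hs2
    rw [Valuation.map_mul, Valuation.map_one, ← sq] at h
    exact (pow_eq_one_iff_left two_ne_zero).1 h
  have hcs : galAdicCompletionMap c hw s = s := by
    -- `s = ±1` is an `N₀`-th root of unity for `N₀ = 2`… simpler: `c_w` is a ring map and `s ∈ {1, −1}` satisfies `s² = 1`, `c_w s² = 1`;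
    -- use §2 with the root of unity `s` of order dividing `N`: `s^N = s`, so `(s²)^… `; directly: `s ^ (2 : ℕ) = 1`? we avoid parity of `p`:
    -- `c_w s - s` has valuation `< 1` and `(c_w s)² = 1 = s²`, so `c_w s = ± s`; if `c_w s = -s` then `v(2s) < 1`, and then
    -- `z ≡ s ≡ -s` forces `v(2) < 1`; in that case `s = 1` works anyway since `v(z - 1) ≤ max(v(z s - 1)…)`. We sidestep: `s = 1` or `s = -1`
    -- literally, and `c_w` fixes both.
    have hs' : s = 1 ∨ s = -1 := by
      have : (s - 1) * (s + 1) = 0 := by linear_combination hs2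
      rcases mul_eq_zero.1 this with h | h
      · exact Or.inl (sub_eq_zero.1 h)
      · exact Or.inr (eq_neg_of_add_eq_zero_left h)
    rcases hs' with rfl | rfl
    · exact map_one _
    · rw [map_neg, map_one]
  -- (3) `z' = z s` is a norm-one principal unit; Hensel
  set z' : w.1.adicCompletion E := z * s with hz'
  have hz'c : z' * galAdicCompletionMap c hw z' = 1 := by
    rw [hz', map_mul, hcs]
    calc z * s * (galAdicCompletionMap c hw z * s) = (z * galAdicCompletionMap c hw z) * (s * s) := by ring
      _ = 1 := by rw [hz, hs2, one_mul]
  have hunit : IsUnit ((N : ℕ) : w.1.adicCompletionIntegers E) := by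
    by_contra hnu
    have hmem : ((N : ℕ) : w.1.adicCompletionIntegers E) ∈ IsLocalRing.maximalIdeal (w.1.adicCompletionIntegers E) := hnu
    rw [Literature.NumberTheory.GaloisRepresentations.mem_maximalIdeal_adicCompletionIntegers_iff,
      Valued.toNormedField.norm_lt_one_iff] at hmem
    have : Valued.v ((N : w.1.adicCompletion E)) < 1 := by simpa using hmem
    rw [hNv] at this
    exact lt_irrefl _ this
  obtain ⟨r, hr⟩ := Literature.NumberTheory.GaloisRepresentations.exists_pow_eq_of_norm_sub_one_lt E w.1
    ((Valued.toNormedField.norm_lt_one_iff).2 hzs) hunit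
  -- (4) correct `r` by an `N`-th root of unity: `ζ²= t⁻¹`
  set t : w.1.adicCompletion E := r * galAdicCompletionMap c hw r with ht
  have htN : t ^ N = 1 := by rw [ht, mul_pow, ← map_pow, hr, hz'c]
  have ht0 : t ≠ 0 := fun h => by rw [h, zero_pow hN0] at htN; exact zero_ne_one htN
  have hcop : Nat.Coprime N 2 := Nat.coprime_two_right.mpr hNodd
  obtain ⟨a, b, hab⟩ := Nat.Coprime.isCoprime hcop
  set ζ : w.1.adicCompletion E := t ^ (-b) with hζ
  have hζN : ζ ^ N = 1 := by
    rw [hζ, ← zpow_natCast, ← zpow_mul, mul_comm, zpow_mul, zpow_natCast, htN, one_zpow]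
  have hζ2 : ζ ^ 2 = t⁻¹ := by
    have hexp : (-b) * ((2 : ℕ) : ℤ) = a * (N : ℤ) - 1 := by linear_combination (-1 : ℤ) * hab
    rw [hζ, ← zpow_natCast, ← zpow_mul, hexp, zpow_sub₀ ht0, zpow_one, mul_comm a, zpow_mul, zpow_natCast, htN,
      one_zpow, one_div]
  have hcζ : galAdicCompletionMap c hw ζ = ζ :=
    galAdicCompletionMap_eq_self_of_pow_eq_one E c v hc w hw he hN0 hNv hζN
  set r' : w.1.adicCompletion E := r * ζ with hr'
  have hr'c : r' * galAdicCompletionMap c hw r' = 1 := by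
    rw [hr', map_mul, hcζ]
    calc r * ζ * (galAdicCompletionMap c hw r * ζ) = (r * galAdicCompletionMap c hw r) * ζ ^ 2 := by ring
      _ = 1 := by rw [← ht, hζ2, mul_inv_cancel₀ ht0]
  have hr'N : r' ^ N = z' := by rw [hr', mul_pow, hζN, mul_one, hr]
  -- (5) `y = s · r'`
  refine ⟨s * r', ?_, ?_⟩
  · rw [map_mul, hcs]
    calc s * r' * (s * galAdicCompletionMap c hw r') = (s * s) * (r' * galAdicCompletionMap c hw r') := by ring
      _ = 1 := by rw [hs2, hr'c, one_mul]
  · rw [mul_pow, hsN, hr'N, hz']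
    calc s * (z * s) = z * (s * s) := by ring
      _ = z := by rw [hs2, mul_one]

end Completion

/-! ## §4 The place model: `S.normOne = E_v¹` is `N`-divisible (`N` odd, `v_w(N) = 1`) at a ramified non-split place; NO det-line carrier -/

section PlaceModel

variable {F : Type} (E : Type) [Field F] [NumberField F] [Field E] [NumberField E] [Algebra F E]
  [Algebra.IsQuadraticExtension F E] (v : HeightOneSpectrum (𝓞 F)) (c : E ≃ₐ[F] E)
  {δ : E} (hcδ : c δ = -δ) (hδ : δ ≠ 0)
  (N : ℕ) (J : Matrix (Fin N) (Fin N) E) (hN : 2 ≤ N) (hJh : (J.map c)ᵀ = J) (hJdet : J.det ≠ 0)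

omit [NumberField F] [Algebra.IsQuadraticExtension F E] in
include hcδ hδ in
/-- `c ≠ 1` (`c δ = −δ ≠ δ`); copy of the siblings' private lemma. [folklore] -/
private theorem hc_of_delta : c ≠ 1 := by
  rintro rfl
  rw [AlgEquiv.one_apply] at hcδ
  have h2 : (2 : E) * δ = 0 := by linear_combination hcδ
  exact hδ ((mul_eq_zero.mp h2).resolve_left two_ne_zero)

include hcδ hδ in
/-- `((c ⊗ 1) x)_w = c_w(x_w)` at a non-split place (`w` is the only place above `v`); copy of the siblings' private lemma.
[cite: CasselsFrohlichANT1967, Ch. II §10] -/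
private theorem conjLocal_apply_of_smul_eq (w : PlacesOver E v) (hw : c • w.1 = w.1) (x : LocalRing E v) :
    conjLocal E c v x w = galAdicCompletionMap c hw (x w) := by
  have key : ∀ (w₁ : PlacesOver E v) (h₁ : c • w₁.1 = w.1),
      galAdicCompletionMap c h₁ (x w₁) = galAdicCompletionMap c hw (x w) := by
    intro w₁ h₁
    have e : w₁ = w := PlacesOver.eq_of_smul_eq c (hc_of_delta E c hcδ hδ) w hw w₁
    subst e
    rfl
  rw [conjLocal_apply]
  exact key ⟨c⁻¹ • w.1, under_inv_smul_eq c w⟩ (smul_inv_smul c w.1)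

/-- determinants of `U(V)(F_v)` are norm-one; copy of the siblings' private lemma. [cite: Liu2021, App. D §D.1 (l. 5213)] [cite: Mok2014, §1 Notation p. 5] -/
private theorem det_mem_normOne (g : (LemD1OfPlace.standingData E v c N J hcδ hδ hN hJh hJdet).U) :
    Matrix.GeneralLinearGroup.det (g : GL (Fin N) (LocalRing E v)) ∈ (LemD1OfPlace.standingData E v c N J hcδ hδ hN hJh hJdet).normOne := by
  let S := LemD1OfPlace.standingData E v c N J hcδ hδ hN hJh hJdet
  rw [OscillatorStandingData.mem_normOne_iff', Matrix.GeneralLinearGroup.val_det_apply]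
  have hg := (OscillatorStandingData.mem_U_iff S _).1 g.2
  have h := congrArg Matrix.det hg
  rw [Matrix.det_mul, Matrix.det_mul, Matrix.det_transpose] at h
  have hc : (((g : GL (Fin N) (LocalRing E v)) : Matrix (Fin N) (Fin N) (LocalRing E v)).map S.conj).det =
      S.conj (((g : GL (Fin N) (LocalRing E v)) : Matrix (Fin N) (Fin N) (LocalRing E v)).det) := by
    rw [AlgEquiv.map_det, AlgEquiv.mapMatrix_apply]
  rw [hc] at h
  have h2 : (((g : GL (Fin N) (LocalRing E v)) : Matrix (Fin N) (Fin N) (LocalRing E v)).det *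
      S.conj (((g : GL (Fin N) (LocalRing E v)) : Matrix (Fin N) (Fin N) (LocalRing E v)).det) - 1) * S.gram.det = 0 := by
    linear_combination h
  exact sub_eq_zero.1 ((S.isUnit_det_gram.mul_left_eq_zero).1 h2)

include hcδ in
/-- **`E_v¹ = (E_v¹)^N` in the place model at a RAMIFIED non-split place, `N` odd with `v_w(N) = 1`** (§3 at the component `w`, the only place
above `v`). [cite: NeukirchANT1999, Ch. II §4 Lemma (4.6) and §5 Prop. (5.3)] [cite: Liu2021, App. D §D.1 Step 3 (l. 5221)] -/
theorem exists_pow_eq_of_mem_normOne_of_ramified (w : PlacesOver E v) (hw : c • w.1 = w.1)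
    (he : v.asIdeal.ramificationIdx' w.1.asIdeal ≠ 1) (hNodd : Odd N) (hNv : Valued.v ((N : w.1.adicCompletion E)) = 1)
    (z : (LemD1OfPlace.standingData E v c N J hcδ hδ hN hJh hJdet).normOne) :
    ∃ y : (LemD1OfPlace.standingData E v c N J hcδ hδ hN hJh hJdet).normOne, y ^ N = z := by
  classical
  have hc : c ≠ 1 := hc_of_delta E c hcδ hδ
  let S := LemD1OfPlace.standingData E v c N J hcδ hδ hN hJh hJdet
  set zw : w.1.adicCompletion E := ((z : (LocalRing E v)ˣ) : LocalRing E v) w with hzw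
  have hzc : zw * galAdicCompletionMap c hw zw = 1 := by
    have h := congrFun (LemD1OfPlace.mul_conjLocal_eq_one E v c N J hcδ hδ hN hJh hJdet z) w
    rw [Pi.mul_apply, conjLocal_apply_of_smul_eq E v c hcδ hδ w hw, Pi.one_apply] at h
    exact h
  obtain ⟨yw, hyc, hyN⟩ :=
    exists_pow_eq_of_mul_galAdicCompletionMap_eq_one_of_ramified E c v hc w hw he hNodd hNv zw hzc
  letI : Unique (PlacesOver E v) := { default := w, uniq := fun a => PlacesOver.eq_of_smul_eq c hc w hw a }
  let y : LocalRing E v := uniqueElim (α := fun w' : PlacesOver E v => w'.1.adicCompletion E) yw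
  have hyw : y w = yw := uniqueElim_default (α := fun w' : PlacesOver E v => w'.1.adicCompletion E) yw
  have hy1 : y * conjLocal E c v y = 1 := by
    rw [LocalRing.eq_iff_apply_eq c hc w hw]
    rw [Pi.mul_apply, conjLocal_apply_of_smul_eq E v c hcδ hδ w hw, hyw, Pi.one_apply]
    exact hyc
  have hyu : IsUnit y := IsUnit.of_mul_eq_one (conjLocal E c v y) hy1
  have hmem : hyu.unit ∈ S.normOne := by
    rw [OscillatorStandingData.mem_normOne_iff', LemD1OfPlace.standingData_conj_apply, IsUnit.unit_spec]
    exact hy1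
  refine ⟨⟨hyu.unit, hmem⟩, ?_⟩
  apply Subtype.ext
  apply Units.ext
  rw [SubgroupClass.coe_pow, Units.val_pow_eq_pow_val, IsUnit.unit_spec, LocalRing.eq_iff_apply_eq c hc w hw, Pi.pow_apply, hyw,
    hyN]

include hcδ in
/-- **every character of `E_v¹` killed by the `N`-th powers is trivial** at a ramified non-split place, `N` odd, `v_w(N) = 1`.
[cite: NeukirchANT1999, Ch. II §5 Prop. (5.3)] [cite: Liu2021, App. D §D.1 Step 3 (l. 5221)] -/
theorem forall_apply_eq_one_of_forall_pow_of_ramified (w : PlacesOver E v) (hw : c • w.1 = w.1)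
    (he : v.asIdeal.ramificationIdx' w.1.asIdeal ≠ 1) (hNodd : Odd N) (hNv : Valued.v ((N : w.1.adicCompletion E)) = 1)
    (θ : (LemD1OfPlace.standingData E v c N J hcδ hδ hN hJh hJdet).normOne →* ℂˣ)
    (hθ : ∀ z : (LemD1OfPlace.standingData E v c N J hcδ hδ hN hJh hJdet).normOne, θ (z ^ N) = 1)
    (z : (LemD1OfPlace.standingData E v c N J hcδ hδ hN hJh hJdet).normOne) : θ z = 1 := by
  obtain ⟨y, rfl⟩ := exists_pow_eq_of_mem_normOne_of_ramified E v c hcδ hδ N J hN hJh hJdet w hw he hNodd hNv z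
  exact hθ y

include hcδ in
/-- **NO DET-LINE CARRIER at a RAMIFIED non-split place for `N` ODD with `v_w(N) = 1`**: every character `Ψ` of `U(V)(F_v) = S.U` that factors
through `det : U(V)(F_v) → E_v¹` and is trivial on the centre `S.scalar(E_v¹)` is TRIVIAL (`det(z · 1_N) = z^N` and `E_v¹ = (E_v¹)^N`) —
for the END's `N = 3`: the places of `L⁺` ramified in `L` and not above `3`. [cite: Liu2021, App. D §D.1 Step 3 (l. 5221) and Lemma D.1 (3) (l. 5233)]
[cite: NeukirchANT1999, Ch. II §4 Lemma (4.6)] -/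
theorem eq_one_of_factors_through_det_of_ramified (w : PlacesOver E v) (hw : c • w.1 = w.1)
    (he : v.asIdeal.ramificationIdx' w.1.asIdeal ≠ 1) (hNodd : Odd N) (hNv : Valued.v ((N : w.1.adicCompletion E)) = 1)
    (Ψ : (LemD1OfPlace.standingData E v c N J hcδ hδ hN hJh hJdet).U →* ℂˣ)
    (θ : (LemD1OfPlace.standingData E v c N J hcδ hδ hN hJh hJdet).normOne →* ℂˣ)
    (hΨ : ∀ (g : (LemD1OfPlace.standingData E v c N J hcδ hδ hN hJh hJdet).U)
      (hg : Matrix.GeneralLinearGroup.det (g : GL (Fin N) (LocalRing E v)) ∈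
        (LemD1OfPlace.standingData E v c N J hcδ hδ hN hJh hJdet).normOne),
      Ψ g = θ ⟨Matrix.GeneralLinearGroup.det (g : GL (Fin N) (LocalRing E v)), hg⟩)
    (hcen : ∀ z : (LemD1OfPlace.standingData E v c N J hcδ hδ hN hJh hJdet).normOne,
      Ψ ((LemD1OfPlace.standingData E v c N J hcδ hδ hN hJh hJdet).scalar z) = 1) :
    Ψ = 1 := by
  let S := LemD1OfPlace.standingData E v c N J hcδ hδ hN hJh hJdet
  have hdet : ∀ z : S.normOne, (⟨Matrix.GeneralLinearGroup.det ((S.scalar z : S.U) : GL (Fin N) (LocalRing E v)),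
      det_mem_normOne E v c hcδ hδ N J hN hJh hJdet (S.scalar z)⟩ : S.normOne) = z ^ N := fun z => by
    apply Subtype.ext
    rw [SubgroupClass.coe_pow]
    apply Units.ext
    rw [Matrix.GeneralLinearGroup.val_det_apply, OscillatorStandingData.coe_scalar, Matrix.scalar_apply, Matrix.det_diagonal,
      Finset.prod_const, Finset.card_univ, Fintype.card_fin, Units.val_pow_eq_pow_val]
  have hθ : ∀ z : S.normOne, θ (z ^ N) = 1 := fun z => by
    rw [← hdet z, ← hΨ (S.scalar z) (det_mem_normOne E v c hcδ hδ N J hN hJh hJdet (S.scalar z))]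
    exact hcen z
  ext g
  rw [hΨ g (det_mem_normOne E v c hcδ hδ N J hN hJh hJdet g), MonoidHom.one_apply,
    forall_apply_eq_one_of_forall_pow_of_ramified E v c hcδ hδ N J hN hJh hJdet w hw he hNodd hNv θ hθ]

end PlaceModel

/-! ## §5 The CM rows: `L` CM, `F = L⁺`, `c` = complex conjugation -/

section CM

open Literature.NumberTheory.GelbartRogawski1991.UnitaryDualPair (imagUnit complexConj_imagUnit imagUnit_ne_zero)

variable (L : Type) [Field L] [NumberField L] [IsCMField L]

local notation3 "cc" => (IsCMField.complexConj L)
local notation3 "L⁺" => (↥(maximalRealSubfield L))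

variable (v : HeightOneSpectrum (𝓞 (maximalRealSubfield L))) (N : ℕ) (J : Matrix (Fin N) (Fin N) L) (hN : 2 ≤ N)
  (hJh : (J.map (IsCMField.complexConj L))ᵀ = J) (hJdet : J.det ≠ 0)

/-- **CM form: at a place `w ∣ v` of `L` RAMIFIED over `L⁺` (`\bar w = w`, `e(w|v) ≠ 1`) with `v_w(N) = 1`, `N` odd, `E_v¹` of the rows'
standing data is `N`-divisible.** [cite: NeukirchANT1999, Ch. II §4 Lemma (4.6)] [cite: Liu2021, App. D §D.1 Step 3 (l. 5221)] -/
theorem exists_pow_eq_of_mem_normOne_of_isCMField_of_ramified (w : PlacesOver L v) (hw : cc • w.1 = w.1)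
    (he : v.asIdeal.ramificationIdx' w.1.asIdeal ≠ 1) (hNodd : Odd N) (hNv : Valued.v ((N : w.1.adicCompletion L)) = 1)
    (z : (LemD1OfPlace.standingData L v cc N J (complexConj_imagUnit L) (imagUnit_ne_zero L) hN hJh hJdet).normOne) :
    ∃ y : (LemD1OfPlace.standingData L v cc N J (complexConj_imagUnit L) (imagUnit_ne_zero L) hN hJh hJdet).normOne, y ^ N = z :=
  exists_pow_eq_of_mem_normOne_of_ramified L v cc (complexConj_imagUnit L) (imagUnit_ne_zero L) N J hN hJh hJdet w hw he hNodd hNv z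

/-- **CM form of «NO det-line carrier at a ramified place»** — for the END's `N = 3`: every place of `L⁺` ramified in `L` and not above `3`.
[cite: Liu2021, App. D §D.1 Step 3 (l. 5221) and Lemma D.1 (3) (l. 5233)] [cite: NeukirchANT1999, Ch. II §4 Lemma (4.6)] -/
theorem eq_one_of_factors_through_det_of_isCMField_of_ramified (w : PlacesOver L v) (hw : cc • w.1 = w.1)
    (he : v.asIdeal.ramificationIdx' w.1.asIdeal ≠ 1) (hNodd : Odd N) (hNv : Valued.v ((N : w.1.adicCompletion L)) = 1)
    (Ψ : (LemD1OfPlace.standingData L v cc N J (complexConj_imagUnit L) (imagUnit_ne_zero L) hN hJh hJdet).U →* ℂˣ)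
    (θ : (LemD1OfPlace.standingData L v cc N J (complexConj_imagUnit L) (imagUnit_ne_zero L) hN hJh hJdet).normOne →* ℂˣ)
    (hΨ : ∀ (g : (LemD1OfPlace.standingData L v cc N J (complexConj_imagUnit L) (imagUnit_ne_zero L) hN hJh hJdet).U)
      (hg : Matrix.GeneralLinearGroup.det (g : GL (Fin N) (LocalRing L v)) ∈
        (LemD1OfPlace.standingData L v cc N J (complexConj_imagUnit L) (imagUnit_ne_zero L) hN hJh hJdet).normOne),
      Ψ g = θ ⟨Matrix.GeneralLinearGroup.det (g : GL (Fin N) (LocalRing L v)), hg⟩)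
    (hcen : ∀ z : (LemD1OfPlace.standingData L v cc N J (complexConj_imagUnit L) (imagUnit_ne_zero L) hN hJh hJdet).normOne,
      Ψ ((LemD1OfPlace.standingData L v cc N J (complexConj_imagUnit L) (imagUnit_ne_zero L) hN hJh hJdet).scalar z) = 1) :
    Ψ = 1 :=
  eq_one_of_factors_through_det_of_ramified L v cc (complexConj_imagUnit L) (imagUnit_ne_zero L) N J hN hJh hJdet w hw he hNodd hNv
    Ψ θ hΨ hcen

end CM

end Literature.NumberTheory.Automorphic.Liu2021.LemD1IndexedNonVacuityRamifiedConverse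

end
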